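import Summits.Schanuel.Schanuel.Theorems.RootDecomp1KSkelCell05

/-!
# RootDecomp1KSkelCell — lens 1, generations 43–44 «THE QUALITY-ONLY CLASS SkelLiouville ⊋ LogLogLiouville AND ITS CERTIFIED MEMBER ρ⋆» (PRICE K-α L2033, CLAIM L2045, ACK L2046; (α) PROPER of the 1K wall map): the location-free class `SkelLiouville ρ := ∀ m ∃ r, m ≤ den r ∧ ρ ≠ r ∧ |ρ − r| < den^{−m·ι(den)}` (ι q = least N with q ≤ 2^{N!}) with `LogLogLiouville ⊊ SkelLiouville ⊆ Liouville` PROVED, the member ρ⋆ = Σ_j 2^{−2^{e_j}} (FREDHOLM SERIES WITH DELETED BLOCKS) certified HYPOTHESIS-FREE in Skel ∖ (LogLog ∪ FactorialGap), the SKEL engine + extraction, the walls (1, ℓ₂, ρ) mod hNW / π-twins and the pair (ℓ₂, ρ) HYPOTHESIS-FREE for every ρ ∈ Skel, the items APPLIED at z⋆ with all binders discharged, the m = 1 ceiling, and §9 hNW DISCHARGED BY NAME on the e-wall via the Literature proof module — continuation (RootDecomp1KSkelCell06): §2 SkelMeasure.mvWeakMeasure + §3 extraction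

(lens-1 g43/g44 HOME kernel SkelCell.lean EDITION 2 b7163857…, 2822 l, imports tree RootDecomp1KGapCell01 (+ for §9 only Literature ExpOneTranscendenceMeasureProofs); CLAIM L2045, ACK L2046 (CHECKLIST K-α (1)–(8) + the constant-dependence line of L2085 (R4)), NODE L2132 / REQUEST L2133, critic VERDICT L2140 (crit g9: CLEARED — ONE CELL credit (K-α); lens-1 tally credits ×11 + THEOREM; PORT GO in substance 01–0k `--supports stmt-Schanuel-33364`, the two scoped heartbeat raises flagged for the port record, addendum D as RootDecomp1KNWMeasureHolds GO LOW); port by census-1 gen 18 as `RootDecomp1KSkelCell01`–`11` along K's sections: 01 = §1 `iota`, `SkelLiouville`, inclusions `SkelLiouville.liouville` / `logLogLiouville_skelLiouville`; 02 = §5a anchors `aI`/`sI` + §5b the skeleton `eS`, positions `cS`, terms `aS` (up to `summable_aS`); 03 = §5b the member `rhoStar`, truncations `tS`/`rS`, bounds + §6 covering / quality lemmas; 04 = §6 THE MEMBER THEOREMS `skelLiouville_rhoStar`, `not_logLogLiouville_rhoStar`, `not_factorialGapLiouville_rhoStar`, `liouville_rhoStar`, `not_skelLiouville_subset_logLogLiouville`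 + §2 engine preliminaries (`SkelMeasure`, `exists_scale_index_iota`); 05 = §2 THE ENGINE `skelMeasure_cons_liouvilleNumber` (scoped `maxHeartbeats 800000` as in K) + `SkelMeasure.mvWeakMeasure`; 06 = §3 EXTRACTION `no_int_relation_of_skelMeasure_skelLiouville`, `sb_of_skelLiouville_of_skelMeasure`; 07 = §4 THE CELLS (pair hyp-free, walls mod hNW, π-twins) + the live items in item shape; 08 = §7 three interlaced cuts `deletedBlock_margins`, `form_lower_bound_S` (scoped `maxHeartbeats 1600000`); 09 = §7b member tuples zS2/zS3/zS3pi, scope certificates, items AT the members; 10 = §8 the fixed-multiple ladder and the m = 1 ceiling (`uStar`, `skel_fixedOne_ceiling`); 11 = §9 hNW DISCHARGED BY NAME (imports Literature ExpOneTranscendenceMeasureProofs).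
PORT EDITS: `set_option linter.dupNamespace false` dropped; the Literature import moved from the head to part 11 (the only user); K's 13 private helpers travel as per-part private copies; two generic helpers made `private` after the dedup bounce of 02 (p829539: `two_mul_le_two_pow` ≡ Literature.NumberTheory.EllipticCurves.two_mul_le_two_pow; also `log_two_lt_self` pre-emptively) and of 03 (p829791: `one_le_loglog` ≡ Literature Tao2016.EntropyDecrement.one_le_log_log; then nine more generic arithmetic helpers privatised pre-emptively: loglog_pow_pow_ge, add_factorial_mul_le_factorial_add, one_lt_ell2, partialSum_two_two, five_fourths_le_partialSum, ell2_lt, psNumer_two_cast, two_pow_lt_psNumer); statements and proofs verbatim. `--supports stmt-Schanuel-33364`; no census credit carried; rung 0 — nothing here proves Schanuel.)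
-/

open Summit.Schanuel.Schanuel.Theorems.RootDecomp1KHyper
open Summit.Schanuel.Schanuel.Theorems.RootDecomp1KHyper.HyperCell
open Summit.Schanuel.Schanuel.Theorems.RootDecomp1KGeneric
open Summit.Schanuel.Schanuel.Theorems.RootDecomp1KRelLiouvilleCell
open Summit.Schanuel.Schanuel.Theorems.RootDecomp1KLogLogCell
open Summit.Schanuel.Schanuel.Theorems.RootDecomp1KTwoBaseCell
open Summit.Schanuel.Schanuel.Theorems.RootDecomp1KGapCell
open LiouvilleNumber
open scoped Nat

namespace Summit.Schanuel.Schanuel.Theorems.RootDecomp1KSkelCell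

section Engine

open Polynomial

/-- the v2 class follows from the Skel class (`ι ≤ log log` above `2^{7!}`; below it `ι ≤ 8`). -/
theorem SkelMeasure.mvWeakMeasure {n : ℕ} {θ : Fin n → ℂ} (hθ : SkelMeasure θ) :
    MvWeakMeasure θ := by
  intro d
  obtain ⟨C, hC, h⟩ := hθ d
  refine ⟨2 * C, 2, by positivity, fun P hP hdeg => le_trans ?_ (h P hP hdeg)⟩
  apply Real.exp_le_exp.mpr
  set L : ℝ := ((mvlen P : ℤ) : ℝ) with hLdef
  have hL1 : (1 : ℝ) ≤ L := by rw [hLdef]; exact_mod_cast one_le_mvlen hP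
  have hLz : (((mvlen P).toNat : ℕ) : ℝ) = L := by
    rw [hLdef]
    have h1 := Int.toNat_of_nonneg (mvlen_nonneg P)
    exact_mod_cast h1
  have hι : (iota (mvlen P).toNat : ℝ) ≤ L := by
    rw [← hLz]; exact_mod_cast iota_le_self _
  have hlog : Real.log L ≤ L - 1 := Real.log_le_sub_one_of_pos (by linarith)
  have h1 : 0 ≤ 1 + Real.log L := by linarith [Real.log_nonneg hL1]
  have h2 : (0 : ℝ) ≤ (iota (mvlen P).toNat : ℝ) := Nat.cast_nonneg _
  have h3 : C * (1 + Real.log L) ≤ C * L := mul_le_mul_of_nonneg_left (by linarith) hC.le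
  have h4 : 1 + (iota (mvlen P).toNat : ℝ) ≤ 2 * L := by linarith
  have h5 : C * (1 + Real.log L) * (1 + (iota (mvlen P).toNat : ℝ)) ≤ C * L * (2 * L) :=
    mul_le_mul h3 h4 (by positivity) (by positivity)
  nlinarith

end Engine

/-! ## §3  EXTRACTION at the log·ι scale: `SkelMeasure θ` + `SkelLiouville ρ` ⇒ `(ρ, θ)` free

(the tree's LogLogCell §3 with `s = log log q` replaced by the INTEGER scale index `w = ι(q)`: the measure
of `θ` at the cleared specialisation `H = q^K P(p/q, X⃗)` costs `exp(−Cm·c₁t·3w)` (`t = log q`,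
`ι(len H) ≤ ι(q) + 1 ≤ 2w` once `q > 2^{K!}` and `q ≥ Cq`), the approximation pays `exp(−m·t·w)`, and
`m` — quantified in the class — absorbs every constant.) -/

section Extraction
open Polynomial IntermediateField

/-- `K ≤ ι(q) ⇒ ι(q^{K+1}) ≤ ι(q) + 1` (`q^{K+1} ≤ 2^{(K+1)·ι(q)!} ≤ 2^{(ι(q)+1)!}`). -/
theorem iota_pow_le {q K : ℕ} (hK : K ≤ iota q) : iota (q ^ (K + 1)) ≤ iota q + 1 := by
  apply iota_le_of_le
  have h1 : q ^ (K + 1) ≤ (2 ^ (iota q)!) ^ (K + 1) := Nat.pow_le_pow_left (iota_spec q) _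
  refine h1.trans ?_
  rw [← pow_mul]
  refine Nat.pow_le_pow_right two_pos ?_
  rw [Nat.factorial_succ]
  calc (iota q)! * (K + 1) ≤ (iota q)! * (iota q + 1) := Nat.mul_le_mul_left _ (by omega)
    _ = (iota q + 1) * (iota q)! := by ring

/-- `1 ≤ log q` for `q ≥ 16` (crude; copy of the tree's private helper). -/
private theorem one_le_log_of_sixteen_le' {x : ℝ} (hx : 16 ≤ x) : 1 ≤ Real.log x := by
  rw [← Real.log_exp 1]
  refine Real.log_le_log (Real.exp_pos 1) (le_trans ?_ hx)
  have := Real.exp_one_lt_d9; linarith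

/-- **Skel extraction in several variables (kernel).** No relation `Σ_{k ≤ K} G_k(θ) ρ^k = 0`,
`G_k ∈ ℤ[X₁, …, Xₙ]` not all zero, between a tuple `θ` with a `SkelMeasure` and a Skel-Liouville `ρ`. -/
theorem no_int_relation_of_skelMeasure_skelLiouville {n : ℕ} {θ : Fin n → ℂ}
    (hθ : SkelMeasure θ) {ρ : ℝ} (hρ : SkelLiouville ρ) {K : ℕ}
    (G : Fin (K + 1) → MvPolynomial (Fin n) ℤ) (hG : ∃ k, G k ≠ 0)
    (hrel : ∑ k : Fin (K + 1), MvPolynomial.aeval θ (G k) * (ρ : ℂ) ^ (k : ℕ) = 0) : False := by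
  classical
  -- the complex polynomial μ(Y) = Σ_k G_k(θ) Y^k
  set μ : ℂ[X] := ∑ k : Fin (K + 1), C (MvPolynomial.aeval θ (G k)) * X ^ (k : ℕ) with hμdef
  have hμeval : ∀ y : ℂ, μ.eval y =
      ∑ k : Fin (K + 1), MvPolynomial.aeval θ (G k) * y ^ (k : ℕ) := by
    intro y
    simp only [hμdef, eval_finsetSum, eval_mul, eval_C, eval_pow, eval_X]
  have hμcoeff : ∀ k : Fin (K + 1), μ.coeff k = MvPolynomial.aeval θ (G k) := by
    intro k
    simp only [hμdef, finsetSum_coeff, coeff_C_mul, coeff_X_pow]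
    rw [Finset.sum_eq_single k]
    · simp
    · intro j _ hjk
      have : (k : ℕ) ≠ (j : ℕ) := fun h => hjk (Fin.ext h).symm
      simp [this]
    · intro h; exact absurd (Finset.mem_univ k) h
  have hμ0 : μ ≠ 0 := by
    obtain ⟨k, hk⟩ := hG
    intro h0
    have h1 : μ.coeff k = 0 := by rw [h0, coeff_zero]
    rw [hμcoeff] at h1
    exact mvaeval_ne_zero_of_skelMeasure hθ hk h1
  have hroot : μ.eval (ρ : ℂ) = 0 := by rw [hμeval]; exact hrel
  obtain ⟨δ, hδ, hδroot⟩ := exists_ball_eval_ne_zero μ hμ0 ρ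
  obtain ⟨M, hM, hLip⟩ := exists_lipschitz_at_root μ ρ hroot
  -- sizes
  set D : ℕ := Finset.univ.sup fun k : Fin (K + 1) => (G k).totalDegree with hDdef
  have hD : ∀ k, (G k).totalDegree ≤ D := fun k =>
    Finset.le_sup (f := fun k : Fin (K + 1) => (G k).totalDegree) (Finset.mem_univ k)
  obtain ⟨Cm, hCm, hmeas⟩ := hθ D
  set Λ : ℤ := ∑ k : Fin (K + 1), mvlen (G k) with hΛ
  have hΛ0 : 0 ≤ Λ := Finset.sum_nonneg fun _ _ => mvlen_nonneg _
  set A : ℕ := ⌈|ρ|⌉₊ + 2 with hA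
  set Cq : ℕ := Λ.toNat * A ^ K + 3 with hCq
  have hCq3 : (3 : ℝ) ≤ Cq := by
    rw [hCq]; push_cast; linarith [show (0:ℝ) ≤ (Λ.toNat : ℝ) * (A : ℝ) ^ K by positivity]
  set c₁ : ℝ := 1 + Real.log Cq + K with hc₁
  have hlogCq : 0 ≤ Real.log Cq := Real.log_nonneg (by linarith)
  have hc₁1 : 1 ≤ c₁ := by rw [hc₁]; linarith [show (0 : ℝ) ≤ K from Nat.cast_nonneg K]
  -- the constant of the lower bound `exp(−c₂ · t · w)` and the class parameter `m`
  set c₂ : ℝ := 3 * Cm * c₁ with hc₂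
  have hc₂0 : 0 ≤ c₂ := by positivity
  set m : ℕ := ⌈c₂⌉₊ + K + ⌈M⌉₊ + 1 with hm
  have hmR : c₂ + K + M + 1 ≤ (m : ℝ) := by
    rw [hm]; push_cast; linarith [Nat.le_ceil c₂, Nat.le_ceil M]
  -- a Skel approximation with a large denominator: q ≥ m, q ≥ Cq, q > 2^{K!}, q ≥ ⌈δ⁻¹⌉ + 16
  obtain ⟨r, hden, hne, hlt⟩ := hρ (max m (Cq + 2 ^ K ! + ⌈δ⁻¹⌉₊ + 16))
  set q : ℕ := r.den with hq
  set p : ℤ := r.num with hp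
  have hden2 : Cq + 2 ^ K ! + ⌈δ⁻¹⌉₊ + 16 ≤ q := (le_max_right _ _).trans hden
  have hden' : ⌈δ⁻¹⌉₊ + 16 ≤ q :=
    le_trans (Nat.add_le_add_right (Nat.le_add_left ⌈δ⁻¹⌉₊ (Cq + 2 ^ K !)) 16) hden2
  have hdenm : m ≤ q := (le_max_left _ _).trans hden
  have h3q : Cq + 2 ^ K ! ≤ q :=
    le_trans (le_trans (Nat.le_add_right _ ⌈δ⁻¹⌉₊) (Nat.le_add_right _ 16)) hden2
  have hCqq : Cq ≤ q := le_trans (Nat.le_add_right _ _) h3q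
  have hCq3N : 3 ≤ Cq := by rw [hCq]; exact Nat.le_add_left 3 _
  have hKfq : 2 ^ K ! < q := by
    have h4 : 2 ^ K ! + 3 ≤ Cq + 2 ^ K ! := by
      rw [add_comm]; exact Nat.add_le_add_right hCq3N _
    exact Nat.lt_of_lt_of_le (Nat.lt_add_of_pos_right (by norm_num)) (h4.trans h3q)
  have hKι : K ≤ iota q := (lt_iota_of_pow_lt hKfq).le
  have hdenR : ((⌈δ⁻¹⌉₊ : ℕ) : ℝ) + 16 ≤ q := by exact_mod_cast hden'
  have hmq : (m : ℝ) ≤ q := by exact_mod_cast hdenm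
  have hceilδ : δ⁻¹ ≤ ⌈δ⁻¹⌉₊ := Nat.le_ceil _
  have hδinv : 0 < δ⁻¹ := inv_pos.mpr hδ
  have hq16 : (16 : ℝ) ≤ q := by linarith
  have hq16N : 16 ≤ q := by exact_mod_cast hq16
  have hq1 : (1 : ℝ) < q := by linarith
  have hqpos : (0 : ℝ) < q := by linarith
  have hq0 : q ≠ 0 := by rintro h; rw [h] at hqpos; simp at hqpos
  have hqinvδ : (q : ℝ)⁻¹ < δ := by
    have h1 : δ⁻¹ < q := by linarith
    exact (inv_lt_comm₀ hδ hqpos).mp h1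
  set t : ℝ := Real.log q with ht
  have ht1 : 1 ≤ t := one_le_log_of_sixteen_le' hq16
  have ht0 : 0 < t := by linarith
  -- the INTEGER scale index of the denominator
  set w : ℝ := (iota q : ℝ) with hw
  have hι1 : 1 ≤ iota q := one_le_iota (by omega)
  have hw1 : 1 ≤ w := by rw [hw]; exact_mod_cast hι1
  have hw0 : 0 < w := by linarith
  -- x := r = p/q as a real number
  set x : ℝ := (r : ℝ) with hx
  have hxpq : x = (p : ℝ) / q := by rw [hx, hp, hq]; exact Rat.cast_def r
  have hqpowinv : ∀ k : ℕ, ((q : ℝ) ^ k)⁻¹ = Real.exp (-((k : ℝ) * t)) := by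
    intro k
    rw [Real.exp_neg, ht, ← Real.log_pow, Real.exp_log (by positivity)]
  have hxρ : |x - ρ| < Real.exp (-((m : ℝ) * t * w)) := by
    rw [abs_sub_comm]
    refine hlt.trans_le ?_
    have h1 : (1 : ℝ) / (q : ℝ) ^ (max m (Cq + 2 ^ K ! + ⌈δ⁻¹⌉₊ + 16) * iota q) ≤
        1 / (q : ℝ) ^ (m * iota q) :=
      one_div_le_one_div_of_le (by positivity)
        (pow_le_pow_right₀ hq1.le (Nat.mul_le_mul_right _ (le_max_left _ _)))
    refine h1.trans (le_of_eq ?_)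
    rw [one_div, hqpowinv, hw]; push_cast; ring_nf
  have hm1 : (1 : ℝ) ≤ m := by
    have : (1 : ℕ) ≤ m := by rw [hm]; omega
    exact_mod_cast this
  have htw1 : 1 ≤ t * w := one_le_mul_of_one_le_of_one_le ht1 hw1
  have httw : t ≤ t * w := le_mul_of_one_le_right ht0.le hw1
  have hqm1 : Real.exp (-((m : ℝ) * t * w)) ≤ (q : ℝ)⁻¹ := by
    have h1 : t ≤ (m : ℝ) * t * w := by
      have h1a : t ≤ (m : ℝ) * t := le_mul_of_one_le_left ht0.le hm1
      have h1b : (m : ℝ) * t ≤ (m : ℝ) * t * w := le_mul_of_one_le_right (by positivity) hw1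
      exact h1a.trans h1b
    calc Real.exp (-((m : ℝ) * t * w)) ≤ Real.exp (-t) := Real.exp_le_exp.mpr (by linarith)
      _ = (q : ℝ)⁻¹ := by rw [ht, Real.exp_neg, Real.exp_log hqpos]
  have hxρ1 : |x - ρ| ≤ 1 := by
    have : (q : ℝ)⁻¹ ≤ 1 := inv_le_one_of_one_le₀ hq1.le
    linarith
  have hxρδ : |x - ρ| < δ := by linarith
  have hxne : x ≠ ρ := fun h => hne (by rw [← h])
  -- (1) μ(x) ≠ 0
  have hμx : μ.eval (x : ℂ) ≠ 0 := hδroot x hxne hxρδ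
  -- (2) the integer polynomial H = q^K P(X, p/q) and its value at θ
  set H : MvPolynomial (Fin n) ℤ := mvspecialise G p q with hH
  have hxC : ((x : ℝ) : ℂ) = (p : ℂ) / (q : ℂ) := by rw [hxpq]; push_cast; rfl
  have hHe : MvPolynomial.aeval θ H = (q : ℂ) ^ K * μ.eval (x : ℂ) := by
    rw [hH, mvaeval_mvspecialise G p hq0 θ, hμeval, hxC]
  have hqC : (q : ℂ) ≠ 0 := by exact_mod_cast hq0
  have hH0 : H ≠ 0 := by
    intro h0
    have : (q : ℂ) ^ K * μ.eval (x : ℂ) = 0 := by rw [← hHe, h0, map_zero]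
    rcases mul_eq_zero.mp this with h | h
    · exact pow_ne_zero K hqC h
    · exact hμx h
  -- (3) upper bound
  have hup : ‖MvPolynomial.aeval θ H‖ < (q : ℝ) ^ K * M * Real.exp (-((m : ℝ) * t * w)) := by
    rw [hHe, norm_mul, norm_pow, Complex.norm_natCast]
    calc (q : ℝ) ^ K * ‖μ.eval (x : ℂ)‖ ≤ (q : ℝ) ^ K * (M * |x - ρ|) := by
          gcongr; exact hLip x hxρ1
      _ < (q : ℝ) ^ K * (M * Real.exp (-((m : ℝ) * t * w))) := by gcongr
      _ = _ := by ring
  -- (4) the length of H: `len H ≤ Cq q^K ≤ q^{K+1}`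
  have hdegH : H.totalDegree ≤ D := totalDegree_mvspecialise_le G p q hD
  have hpq_bound : (|p| : ℤ) + q ≤ (A : ℤ) * q := by
    have h2 : |(p : ℝ) / q| ≤ |ρ| + 1 := by
      calc |(p : ℝ) / q| = |(x - ρ) + ρ| := by rw [hxpq]; ring_nf
        _ ≤ |x - ρ| + |ρ| := abs_add_le _ _
        _ ≤ |ρ| + 1 := by linarith
    rw [abs_div, abs_of_pos hqpos, div_le_iff₀ hqpos] at h2
    have h3 : |ρ| ≤ ⌈|ρ|⌉₊ := Nat.le_ceil _
    have h4a : (|ρ| + 1) * (q : ℝ) ≤ ((⌈|ρ|⌉₊ : ℝ) + 1) * q :=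
      mul_le_mul_of_nonneg_right (by linarith) hqpos.le
    have h4 : |(p : ℝ)| + q ≤ ((⌈|ρ|⌉₊ : ℝ) + 2) * q := by linarith
    have h5 : (((|p| + q : ℤ)) : ℝ) ≤ (((A : ℤ) * q : ℤ) : ℝ) := by
      rw [hA]; push_cast; linarith
    exact_mod_cast h5
  have hpq0 : (0 : ℤ) ≤ |p| + q := by positivity
  have hlenH : mvlen H ≤ ((Cq * q ^ K : ℕ) : ℤ) := by
    calc mvlen H ≤ (|p| + q) ^ K * Λ := mvlen_mvspecialise_le G p q
      _ ≤ ((A : ℤ) * q) ^ K * Λ := by gcongr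
      _ = (A : ℤ) ^ K * (q : ℤ) ^ K * Λ := by ring
      _ ≤ (A : ℤ) ^ K * (q : ℤ) ^ K * Λ.toNat + 3 * (q : ℤ) ^ K := by
          have h1 : Λ ≤ Λ.toNat := Int.self_le_toNat Λ
          have h2 : (0 : ℤ) ≤ (A : ℤ) ^ K * (q : ℤ) ^ K := by positivity
          have h3 : (0 : ℤ) ≤ 3 * (q : ℤ) ^ K := by positivity
          exact le_add_of_le_of_nonneg (mul_le_mul_of_nonneg_left h1 h2) h3
      _ = ((Cq * q ^ K : ℕ) : ℤ) := by rw [hCq]; push_cast; ring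
  have hlenN : (mvlen H).toNat ≤ q ^ (K + 1) := by
    have h1 : (mvlen H).toNat ≤ Cq * q ^ K := by
      have h2 : mvlen H ≤ ((Cq * q ^ K : ℕ) : ℤ) := hlenH
      omega
    refine h1.trans ?_
    rw [pow_succ']
    exact Nat.mul_le_mul_right _ hCqq
  have hιH : iota (mvlen H).toNat ≤ iota q + 1 := (iota_mono hlenN).trans (iota_pow_le hKι)
  have hlenR : ((mvlen H : ℤ) : ℝ) ≤ (Cq : ℝ) * (q : ℝ) ^ K := by
    have h1 : (((mvlen H : ℤ)) : ℝ) ≤ (((Cq * q ^ K : ℕ) : ℤ) : ℝ) := by exact_mod_cast hlenH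
    have h2 : (((Cq * q ^ K : ℕ) : ℤ) : ℝ) = (Cq : ℝ) * (q : ℝ) ^ K := by push_cast; ring
    rw [← h2]; exact h1
  have hlen1 : (1 : ℝ) ≤ ((mvlen H : ℤ) : ℝ) := by exact_mod_cast one_le_mvlen hH0
  -- (5) the lower bound of the measure: `1 + log (mvlen H) ≤ c₁ t`, `1 + ι(len H) ≤ 3 w`
  have hlow : Real.exp (-(Cm * (1 + Real.log ((mvlen H : ℤ) : ℝ)) *
      (1 + (iota (mvlen H).toNat : ℝ)))) ≤ ‖MvPolynomial.aeval θ H‖ :=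
    hmeas H hH0 hdegH
  set U : ℝ := 1 + Real.log ((mvlen H : ℤ) : ℝ) with hU
  have hU1 : 1 ≤ U := by rw [hU]; linarith [Real.log_nonneg hlen1]
  have hUle : U ≤ c₁ * t := by
    have h1 : Real.log ((mvlen H : ℤ) : ℝ) ≤ Real.log ((Cq : ℝ) * (q : ℝ) ^ K) :=
      Real.log_le_log (by linarith) hlenR
    rw [Real.log_mul (by linarith) (by positivity), Real.log_pow] at h1
    rw [hU, hc₁]
    have h2 : (1 + Real.log Cq) ≤ (1 + Real.log Cq) * t := le_mul_of_one_le_right (by linarith) ht1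
    rw [← ht] at h1
    have e : (1 + Real.log ↑Cq + ↑K) * t = (1 + Real.log Cq) * t + ↑K * t := by ring
    rw [e]
    linarith
  have hVle : 1 + (iota (mvlen H).toNat : ℝ) ≤ 3 * w := by
    have h1 : (iota (mvlen H).toNat : ℝ) ≤ (iota q : ℝ) + 1 := by exact_mod_cast hιH
    rw [hw]; linarith
  have hlow' : Real.exp (-(c₂ * t * w)) ≤ ‖MvPolynomial.aeval θ H‖ := by
    refine le_trans (Real.exp_le_exp.mpr (neg_le_neg ?_)) hlow
    have hV0 : (0 : ℝ) ≤ 1 + (iota (mvlen H).toNat : ℝ) := by positivity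
    calc Cm * U * (1 + (iota (mvlen H).toNat : ℝ)) ≤ Cm * (c₁ * t) * (3 * w) :=
          mul_le_mul (mul_le_mul_of_nonneg_left hUle hCm.le) hVle hV0 (by positivity)
      _ = c₂ * t * w := by rw [hc₂]; ring
  -- (6) the clash: `K t + log M − m t w ≤ −c₂ t w`
  have hchain := hlow'.trans_lt hup
  have hqK : (q : ℝ) ^ K = Real.exp (K * t) := by
    rw [ht, ← Real.log_pow, Real.exp_log (by positivity)]
  have hMexp : M = Real.exp (Real.log M) := (Real.exp_log hM).symm
  have hlogM : Real.log M ≤ M * (t * w) := by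
    have h1 : Real.log M ≤ M := (Real.log_le_sub_one_of_pos hM).trans (by linarith)
    have h2 : M * 1 ≤ M * (t * w) := mul_le_mul_of_nonneg_left htw1 hM.le
    linarith
  have hfin : (q : ℝ) ^ K * M * Real.exp (-((m : ℝ) * t * w)) ≤ Real.exp (-(c₂ * t * w)) := by
    rw [hqK, hMexp, ← Real.exp_add, ← Real.exp_add]
    refine Real.exp_le_exp.mpr ?_
    have h1 := mul_le_mul_of_nonneg_right hmR (zero_le_one.trans htw1)
    have e : (c₂ + ↑K + M + 1) * (t * w) = c₂ * (t * w) + ↑K * (t * w) + M * (t * w) + t * w := by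
      ring
    rw [e] at h1
    have h2 : (K : ℝ) * t ≤ K * (t * w) := mul_le_mul_of_nonneg_left httw (Nat.cast_nonneg K)
    have e2 : (m : ℝ) * t * w = m * (t * w) := mul_assoc _ _ _
    have e3 : c₂ * t * w = c₂ * (t * w) := mul_assoc _ _ _
    rw [e2, e3]
    linarith
  exact absurd hchain (not_lt.mpr hfin)

/-- **Skel class principle in several variables (kernel).** A tuple `θ` with a `SkelMeasure` and a
Skel-Liouville `ρ` form an algebraically independent `(n+1)`-tuple `(ρ, θ₁, …, θₙ)`. -/
theorem algebraicIndependent_option_of_skelMeasure_skelLiouville {n : ℕ} {θ : Fin n → ℂ}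
    (hθ : SkelMeasure θ) {ρ : ℝ} (hρ : SkelLiouville ρ) :
    AlgebraicIndependent ℚ (fun o : Option (Fin n) => o.elim (ρ : ℂ) θ) := by
  have hθi := algebraicIndependent_of_mvWeakMeasure hθ.mvWeakMeasure
  rw [hθi.option_iff_transcendental]
  intro halg
  obtain ⟨K, G, hGK, hrel⟩ := exists_int_mvrelation halg
  exact no_int_relation_of_skelMeasure_skelLiouville hθ hρ G ⟨Fin.last K, hGK⟩ hrel

/-- Schanuel's bound from it: a tuple `z : Fin (n+1) → ℂ` whose Schanuel field contains a Skel-Liouville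
real and `n` numbers with a simultaneous Skel measure has `trdeg ≥ n + 1`. -/
theorem sb_of_skelLiouville_of_skelMeasure {n : ℕ} {z : Fin (n + 1) → ℂ}
    {ρ : ℝ} (hρ : SkelLiouville ρ) (hρz : (ρ : ℂ) ∈ adjoin ℚ (SFset z ∪ {Complex.I}))
    {θ : Fin n → ℂ} (hθ : SkelMeasure θ) (hθz : ∀ j, θ j ∈ adjoin ℚ (SFset z ∪ {Complex.I})) :
    SB (n + 1) z := by
  have hai := algebraicIndependent_option_of_skelMeasure_skelLiouville hθ hρ
  refine sb_of_algebraicIndependent hai (by simp) fun o => ?_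
  cases o with
  | none => exact hρz
  | some j => exact hθz j

end Extraction

end Summit.Schanuel.Schanuel.Theorems.RootDecomp1KSkelCell
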